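import Literature.AlgebraicGeometry.ShimuraVarieties.UnitaryBallSpecialCurveDatum
import Literature.AlgebraicGeometry.ShimuraVarieties.UnitaryBallSpecialCycleNonvacuity
import Literature.NumberTheory.Automorphic.UnitaryGroupFieldRangeTransport
import HarnessLib

/-!
# The special curve datum of a framed line, read over a SUBFIELD CODE of the piece datum (road (ii), leaf L3.3)

Topic `AlgebraicGeometry/ShimuraVarieties`; namespace
`Literature.AlgebraicGeometry.ShimuraVarieties.UnitaryBallUniformisationDatum`.  THEOREMS ONLY (no definition, no named
fact, no instance).

The PIECES of the complex fibre of the canonical model of a compact unitary Shimura surface are handed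
(`UnitaryCanonicalModel.RecordSystem.pieces`) as data `D : UnitaryBallUniformisationDatum 2 X_q` over an ∃-bound subfield
`D.E ⊆ ℂ`; by the cell's ruling «E-opacity / PINNED» a Literature leaf reads them through a SUBFIELD CODE
`e : L ≃+* D.E` over `τ` with `D.H = H^e` (the currency of `UnitaryBallH1RestrictionSubfieldCode`), the surface datum being
`(L, H, τ)` with an `L`-rational frame `ᵗc(B)·(a•H)·B = J⋆ ⊕ᶠ J⊥` (`UnitaryShimuraCurveEmbeddingPoints.frameEmbNeg`).  This
file turns the datum-side theorems of the F-series (`exists_specialCurveSubscheme`, `exists_specialCurveDatum`) into the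
SHAPE consumed by the cofan leaf `UnitaryCanonicalModel.exists_cofan_pieces_of_specialCurves` (L3.6): for the line
`W = D.E·(GL(e)B)e₃` of the translated frame,

* §1 `exists_quotientDatum_eq` — every `UnitaryBallUniformisationDatum 2 X` EXTENDS to a `UnitaryBallQuotientDatum 2 X`
  (its special subvarieties supplied by the theorem `PicardCM.specialCyclesAlgebraic_holds`);
* §2 scalar bookkeeping: `formCongr σ T (c • H) = c • formCongr σ T H`, `c • (J₁ ⊕ᶠ J₂) = cJ₁ ⊕ᶠ cJ₂`,
  `U(σ, c•J) = U(σ, J)` and `IsCongruenceSubgroup σ (c • J) Γ ↔ IsCongruenceSubgroup σ J Γ`, `negCone (r • J) = negCone J`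
  (`r > 0` real);
* §3 the frame TRANSPORTED along the code: `ᵗσ(GL(e)B)·D.H·GL(e)B = (a⁻¹J⋆)^e ⊕ᶠ (a⁻¹J⊥)^e`; total positivity of the line
  from `Re τ(J⊥₀₀) > 0` at the ONE place `τ` and the datum's own `posDef_of_ne` elsewhere (`forall_re_pos_subformRight`);
* §4 HEAD **`exists_specialCurveDatum_of_subfieldCode`** — a reduced closed subscheme `κ : Z ↪ X`, smooth projective of
  dimension `1`, with a disc datum `B₁ : UnitaryBallUniformisationDatum 1 Z` such that `B₁.Hℂ = (a⁻¹ • J⋆)^τ`,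
  `τ₁(B₁.Γ) = τ(Γ₁)`, `κ(ℂ)(B₁.unif v) = D.unif (B^τ(v ⊕ 0))` on `negCone J⋆^τ`, and whose image is the special cycle of
  `W`: `P.pt ∈ range κ ↔ P ∈ D.unif '' subCone(W^τ)`.

References: N. Bergeron, J. Millson, C. Moeglin, Acta Math. 216 (2016), Part 2 §§1.1–1.4, 3.1–3.3; S. Kudla, J. Millson,
Publ. Math. IHÉS 71 (1990), Lemma 1.1; Y. Liu, Camb. J. Math. 9 (2021), proof of Thm. 4.15; P. Deligne, *Variétés de
Shimura* (1979), 2.1.2.  Cell `hodgecm-mathlib`, road (ii) CUT-R2-5-FIELDS leaf L3.3 (A-plan1 (g9) ruling «PINNED»,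
2026-08-29).  HC_CM is proved only modulo the 7 printed citations until rung 0 closes; nothing here is in a registered cone.
-/

set_option autoImplicit false

noncomputable section

open scoped ComplexOrder
open Matrix Complex NumberField Set Function CategoryTheory AlgebraicGeometry
open Literature.NumberTheory.Automorphic
open Literature.NumberTheory.Automorphic.UnitaryGroup (finSum reindexGL blockDiagGL finSum_map)
open Literature.NumberTheory.Transcendental Literature.AlgebraicGeometry.Motives

namespace Literature.AlgebraicGeometry.ShimuraVarieties

/-! ### §1 Every uniformisation datum extends to a quotient datum -/

namespace UnitaryBallUniformisationDatum

variable {X : SchemeOver ℂ} (D : UnitaryBallUniformisationDatum 2 X)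

/-- **Every `UnitaryBallUniformisationDatum 2 X` extends to a `UnitaryBallQuotientDatum 2 X`**: the special
subvarieties (Zariski-closed, with the prescribed complex points and codimension) are supplied by the THEOREM
`PicardCM.specialCyclesAlgebraic_holds` (Kudla–Millson Lemma 1.1 + Chow). [cite: KudlaMillson1990, Lemma 1.1, p. 128 and p. 133]
[cite: BergeronMillsonMoeglin2016Balls, Introduction §1.7] -/
theorem exists_quotientDatum_eq : ∃ D' : UnitaryBallQuotientDatum 2 X, D'.toUnitaryBallUniformisationDatum = D := by
  classical
  have h := fun (W : Submodule D.E (Fin 3 → D.E)) (hW : IsTotallyPositive (conjRingHom D.E) D.H W) =>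
    Literature.NumberTheory.Automorphic.PicardCM.specialCyclesAlgebraic_holds D.E D.H D.Γ X D.unif
      D.conj_H_apply D.anisotropic D.signature_τ₁ D.posDef_of_ne D.isCongruenceSubgroup D.torsionFree
      D.isSmoothProjective D.isBallUniformisation W hW
  refine ⟨{ toUnitaryBallUniformisationDatum := D
            specialSubvariety := fun W =>
              if hW : IsTotallyPositive (conjRingHom D.E) D.H W then (h W hW).choose else ∅
            isClosed_specialSubvariety := fun W hW => by
              simp only [dif_pos hW]
              exact (h W hW).choose_spec.1
            pt_mem_specialSubvariety_iff := fun W hW P => by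
              simp only [dif_pos hW]
              exact (h W hW).choose_spec.2.1 P
            le_coheight_of_mem_specialSubvariety := fun W hW z hz => by
              simp only [dif_pos hW] at hz ⊢
              exact (h W hW).choose_spec.2.2 z hz }, rfl⟩

end UnitaryBallUniformisationDatum

/-! ### §2 Scalar bookkeeping -/

section Scalars

variable {R : Type*} [CommRing R] {n : Type*} [Fintype n] [DecidableEq n] (σ : R →+* R)

/-- `ᵗσ(T)·(c•H)·T = c • ᵗσ(T)·H·T`. [cite: BergeronMillsonMoeglin2016Balls, Part 2 §1.1] -/
theorem formCongr_smul (T : GL n R) (c : R) (H : Matrix n n R) : formCongr σ T (c • H) = c • formCongr σ T H := by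
  simp only [formCongr, Matrix.mul_smul, Matrix.smul_mul]

/-- `c • (J₁ ⊕ᶠ J₂) = (c•J₁) ⊕ᶠ (c•J₂)`. [cite: BergeronMillsonMoeglin2016Balls, Part 2 §3.1] -/
theorem smul_finSum {N₁ N₂ : ℕ} (c : R) (J₁ : Matrix (Fin N₁) (Fin N₁) R) (J₂ : Matrix (Fin N₂) (Fin N₂) R) :
    c • finSum N₁ N₂ J₁ J₂ = finSum N₁ N₂ (c • J₁) (c • J₂) := by
  ext i j
  simp only [finSum, Matrix.reindex_apply, Matrix.smul_apply, Matrix.submatrix_apply]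
  rcases finSumFinEquiv.symm i with i | i <;> rcases finSumFinEquiv.symm j with j | j <;>
    simp [Matrix.fromBlocks]

end Scalars

section ScalarsField

variable {E : Type*} [Field E] {n : Type*} [Fintype n] [DecidableEq n] (σ : E →+* E)

/-- `U(σ, c•J) = U(σ, J)` for a `σ`-fixed non-zero scalar. [cite: BergeronMillsonMoeglin2016Balls, Part 2 §1.1] -/
theorem unitaryGroup_smul {c : E} (hc : c ≠ 0) (J : Matrix n n E) : unitaryGroup σ (c • J) = unitaryGroup σ J := by
  ext g
  rw [mem_unitaryGroup_iff, mem_unitaryGroup_iff, Matrix.mul_smul, Matrix.smul_mul]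
  exact ⟨fun h => smul_right_injective _ hc h, fun h => by rw [h]⟩

/-- The principal congruence subgroups of `c•J` and `J` agree. [cite: BergeronMillsonMoeglin2016Balls, Part 2 §1.4] -/
theorem principalCongruenceSubgroup_smul [NumberField E] {c : E} (hc : c ≠ 0) (J : Matrix n n E) (k : ℕ) :
    principalCongruenceSubgroup σ (c • J) k = principalCongruenceSubgroup σ J k := by
  ext g
  change g ∈ unitaryGroup σ (c • J) ∧ _ ↔ g ∈ unitaryGroup σ J ∧ _
  rw [unitaryGroup_smul σ hc]

/-- **Congruence subgroups do not see a rescaling of the form.** [cite: BergeronMillsonMoeglin2016Balls, Part 2 §1.4] -/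
theorem isCongruenceSubgroup_smul_iff [NumberField E] {c : E} (hc : c ≠ 0) (J : Matrix n n E) (Γ : Subgroup (GL n E)) :
    IsCongruenceSubgroup σ (c • J) Γ ↔ IsCongruenceSubgroup σ J Γ := by
  unfold IsCongruenceSubgroup
  simp only [unitaryGroup_smul σ hc, principalCongruenceSubgroup_smul σ hc]

/-- **The negative cone does not see a positive real rescaling**: `negCone (r • J) = negCone J` for `r > 0`.
[cite: BergeronMillsonMoeglin2016Balls, Part 2 §1.3] -/
theorem negCone_real_smul {m : Type*} [Fintype m] {r : ℝ} (hr : 0 < r) (J : Matrix m m ℂ) :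
    negCone ((r : ℂ) • J) = negCone J := by
  ext v
  rw [mem_negCone_iff, mem_negCone_iff, Matrix.smul_mulVec, dotProduct_smul, smul_eq_mul, Complex.re_ofReal_mul]
  constructor
  · intro h
    by_contra h'
    exact absurd h (not_lt.2 (mul_nonneg hr.le (not_lt.1 h')))
  · intro h
    exact mul_neg_of_pos_of_neg hr h

end ScalarsField

/-! ### §3 The frame transported along a subfield code -/

namespace UnitaryBallUniformisationDatum

variable {L : Type} [Field L] [NumberField L] [IsCMField L] (τ : L →+* ℂ)
  {X : SchemeOver ℂ} (D : UnitaryBallUniformisationDatum 2 X)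
  (e : L ≃+* ↥D.E) (he : ∀ x : L, ((e x : ↥D.E) : ℂ) = τ x)
  {Hm : Matrix (Fin 3) (Fin 3) L} (hH : D.H = Hm.map e.toRingHom)
  (BL : GL (Fin 3) L) {a : L} (ha : a ≠ 0) (Jstar : Matrix (Fin 2) (Fin 2) L) (Jperp : Matrix (Fin 1) (Fin 1) L)
  (hBL : formCongr (IsCMField.complexConj L).toRingEquiv.toRingHom BL (a • Hm) = finSum 2 1 Jstar Jperp)

omit [NumberField L] [IsCMField L] in
/-- `(c • M)^f = f(c) • M^f` for a ring homomorphism (plumbing). [folklore] -/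
private theorem map_smul' {m k : Type*} {S : Type*} [CommRing S] (f : L →+* S) (c : L) (M : Matrix m k L) :
    (c • M).map f = f c • M.map f := by
  ext i j; simp [Matrix.map_apply, map_mul]

include he hH ha hBL in
/-- **The transported frame**: `ᵗσ(GL(e)B)·D.H·GL(e)B = (a⁻¹J⋆)^e ⊕ᶠ (a⁻¹J⊥)^e` for a subfield code `D.H = H^e` and an
`L`-frame `ᵗc(B)·(a•H)·B = J⋆ ⊕ᶠ J⊥`. [cite: BergeronMillsonMoeglin2016Balls, Part 2 §3.1] [cite: Kudla1984, §1] -/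
theorem formCongr_glMap_code_eq_finSum :
    formCongr (conjRingHom D.E) (Matrix.GeneralLinearGroup.map e.toRingHom BL) D.H =
      finSum 2 1 ((a⁻¹ • Jstar).map e) ((a⁻¹ • Jperp).map e) := by
  have hσ : ∀ x, conjRingHom D.E (e x) = e ((IsCMField.complexConj L).toRingEquiv.toRingHom x) :=
    fun x => CodeField.conjRingHom_ringEquiv_apply τ e he x
  have hL : formCongr (IsCMField.complexConj L).toRingEquiv.toRingHom BL Hm = finSum 2 1 (a⁻¹ • Jstar) (a⁻¹ • Jperp) := by
    have h1 : a⁻¹ • formCongr (IsCMField.complexConj L).toRingEquiv.toRingHom BL (a • Hm) =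
        formCongr (IsCMField.complexConj L).toRingEquiv.toRingHom BL Hm := by
      rw [formCongr_smul, smul_smul, inv_mul_cancel₀ ha, one_smul]
    rw [← h1, hBL, smul_finSum]
  have hH' : D.H = Hm.map e := by rw [hH, RingEquiv.toRingHom_eq_coe, RingHom.coe_coe]
  rw [hH']
  exact CodeField.formCongr_glMap_ringEquiv_eq_finSum (N₁ := 2) (N₂ := 1) e hσ BL Hm (a⁻¹ • Jstar) (a⁻¹ • Jperp) hL

omit [NumberField L] [IsCMField L] in
include he in
/-- The complex read-out of the transported Gram block: `((a⁻¹•J)^e)^{subtype} = (a⁻¹•J)^τ = τ(a)⁻¹ • J^τ`.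
[cite: BergeronMillsonMoeglin2016Balls, Part 2 §1.1] -/
theorem map_code_smul_map_subtype {m k : Type*} (J : Matrix m k L) :
    ((a⁻¹ • J).map e).map D.E.subtype = ((τ a)⁻¹ : ℂ) • J.map τ := by
  rw [CodeField.map_ringEquiv_map_subtype τ e he (a⁻¹ • J), map_smul', map_inv₀]

/-- **Total positivity of `J⊥₀₀` from ONE place**: if `ᵗσ(B)·H·B = J⋆ ⊕ᶠ J⊥` frames the datum and `Re J⊥₀₀ > 0` at the
inclusion `D.E ⊆ ℂ`, then `Re τ′(J⊥₀₀) > 0` at EVERY embedding `τ′` — at the place of the inclusion by conjugation, elsewhere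
because `H^{τ′}` is positive definite (`D.posDef_of_ne`) and `J⊥₀₀ = ⟨Be₃, Be₃⟩_H`.
[cite: BergeronMillsonMoeglin2016Balls, Introduction §1.7 and Part 2 §1.1] -/
theorem forall_re_pos_subformRight (B : GL (Fin 3) D.E) (Jstar' : Matrix (Fin 2) (Fin 2) D.E)
    (Jperp' : Matrix (Fin 1) (Fin 1) D.E) (hB : formCongr (conjRingHom D.E) B D.H = finSum 2 1 Jstar' Jperp')
    (h₁ : 0 < (D.E.subtype (Jperp' 0 0)).re) : ∀ τ' : ↥D.E →+* ℂ, 0 < (τ' (Jperp' 0 0)).re := by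
  intro τ'
  by_cases hτ' : InfinitePlace.mk τ' = InfinitePlace.mk D.E.subtype
  · rcases InfinitePlace.mk_eq_iff.1 hτ' with h | h
    · rw [h]; exact h₁
    · rw [← h, ComplexEmbedding.conjugate_coe_eq, Complex.conj_re] at h₁
      exact h₁
  · -- off the place of the inclusion `H^{τ′}` is positive definite
    have hpd := D.posDef_of_ne τ' hτ'
    have hs0 : (⇑τ' ∘ fun i => (B : Matrix (Fin 3) (Fin 3) D.E) i (Fin.last 2)) ≠ 0 := by
      intro h0
      apply D.lastCol_ne_zero B
      funext i
      have h1 := congrFun h0 i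
      simp only [Function.comp_apply, Pi.zero_apply, map_eq_zero] at h1
      exact h1
    have hpos := hpd.dotProduct_mulVec_pos hs0
    rw [← D.hermForm_lastCol_lastCol B Jstar' Jperp' hB, map_hermForm τ' (embedding_conjRingHom D.E τ'),
      hermForm_starRingEnd]
    exact (Complex.pos_iff.1 hpos).1

omit [NumberField L] [IsCMField L] in
include he in
/-- `Re ((a⁻¹J⊥)^e)₀₀ > 0` at the inclusion, from `Re τ(J⊥₀₀) > 0` and `τ a` a positive real.
[cite: BergeronMillsonMoeglin2016Balls, Part 2 §3.1] -/
theorem re_pos_code_subformRight (hτa : 0 < (τ a).re) (hτa' : (τ a).im = 0) (hpos : 0 < (τ (Jperp 0 0)).re) :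
    0 < (D.E.subtype (((a⁻¹ • Jperp).map e) 0 0)).re := by
  have h1 : D.E.subtype (((a⁻¹ • Jperp).map e) 0 0) = (τ a)⁻¹ * τ (Jperp 0 0) := by
    rw [Matrix.map_apply, Matrix.smul_apply, smul_eq_mul, Subfield.coe_subtype, he, map_mul, map_inv₀]
  have hreal : τ a = ((τ a).re : ℂ) := Complex.ext rfl (by rw [Complex.ofReal_im]; exact hτa')
  rw [h1, hreal, ← Complex.ofReal_inv, Complex.re_ofReal_mul]
  exact mul_pos (inv_pos.2 hτa) hpos

/-! ### §4 The special curve datum of the framed line, over the code -/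

include he hH ha hBL in
/-- **L3.3 F-REIDX (datum side): the special curve of the line `W = D.E·(GL(e)B)e₃` of a piece, with its disc datum, over a
subfield code.**  Let `D : UnitaryBallUniformisationDatum 2 X` be a piece datum coded by `e : L ≃+* D.E` over `τ` with
`D.H = H^e`, `ᵗc(B)·(a•H)·B = J⋆ ⊕ᶠ J⊥` an `L`-frame (`τ a` a positive real, `Re τ(J⊥₀₀) > 0`), `𝔣` a Sylvester frame of `D`,
`Γ₁ ≤ GL₂(L)` a level which, transported by `e`, is a congruence subgroup of `U(a⁻¹J⋆)` JOINED to `D.Γ` along the transported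
frame `B′ = GL(e)B` (`B′(γ₁ ⊕ 1)B′⁻¹ ∈ D.Γ` for `γ₁ ∈ Γ₁`, and every element of the stabiliser `Γ_W` is of this form), and
assume the injectivity of the level at `W` (`hinj`).  Then there are a reduced closed subscheme `κ : Z ↪ X` and a disc datum
`B₁ : UnitaryBallUniformisationDatum 1 Z` (so `Z` is smooth projective of dimension `1`) with `B₁.Hℂ = (a⁻¹•J⋆)^τ`,
`τ₁(B₁.Γ) = τ(Γ₁)`, `κ(ℂ)(B₁.unif v) = D.unif (B^τ(v ⊕ 0))` on `negCone J⋆^τ`, and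
`P.pt ∈ range κ ↔ P ∈ D.unif '' subCone_{H^{τ₁}}(τ₁ W)` — the hypotheses `(Z_r, κ_r, B⋆_r, hf)` of
`UnitaryCanonicalModel.exists_cofan_pieces_of_specialCurves`.
[cite: BergeronMillsonMoeglin2016Balls, Part 2 §§3.1–3.3] [cite: KudlaMillson1990, Lemma 1.1, p. 128 and p. 133]
[cite: Liu2021, proof of Thm. 4.15 l. 2207] -/
theorem exists_specialCurveDatum_of_subfieldCode (𝔣 : D.SylvesterFrame)
    (hτa : 0 < (τ a).re) (hτa' : (τ a).im = 0) (hpos : 0 < (τ (Jperp 0 0)).re)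
    (Γ₁ : Subgroup (GL (Fin 2) L))
    (hΓ₁ : IsCongruenceSubgroup (conjRingHom D.E) ((a⁻¹ • Jstar).map e)
      (Γ₁.map (Matrix.GeneralLinearGroup.map e.toRingHom)))
    (hΓ₁Γ : ∀ γ₁ ∈ Γ₁, Matrix.GeneralLinearGroup.map e.toRingHom BL *
      reindexGL finSumFinEquiv (blockDiagGL (Matrix.GeneralLinearGroup.map e.toRingHom γ₁, (1 : GL (Fin 1) ↥D.E))) *
      (Matrix.GeneralLinearGroup.map e.toRingHom BL)⁻¹ ∈ D.Γ)
    (hΓΓ₁ : ∀ γ : D.Γ, γ ∈ D.lineStab (D.E ∙ fun i =>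
        ((Matrix.GeneralLinearGroup.map e.toRingHom BL : GL (Fin 3) ↥D.E) : Matrix (Fin 3) (Fin 3) ↥D.E) i (Fin.last 2)) →
      ∃ γ₁ ∈ Γ₁, (γ : GL (Fin 3) ↥D.E) = Matrix.GeneralLinearGroup.map e.toRingHom BL *
        reindexGL finSumFinEquiv (blockDiagGL (Matrix.GeneralLinearGroup.map e.toRingHom γ₁, (1 : GL (Fin 1) ↥D.E))) *
        (Matrix.GeneralLinearGroup.map e.toRingHom BL)⁻¹)
    (hinj : ∀ γ : D.Γ, (∃ z ∈ D.specialBall 𝔣 {fun i =>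
        ((Matrix.GeneralLinearGroup.map e.toRingHom BL : GL (Fin 3) ↥D.E) : Matrix (Fin 3) (Fin 3) ↥D.E) i (Fin.last 2)},
        D.ballRep 𝔣 γ • z ∈ D.specialBall 𝔣 {fun i =>
          ((Matrix.GeneralLinearGroup.map e.toRingHom BL : GL (Fin 3) ↥D.E) : Matrix (Fin 3) (Fin 3) ↥D.E) i (Fin.last 2)}) →
      γ ∈ D.lineStab (D.E ∙ fun i =>
        ((Matrix.GeneralLinearGroup.map e.toRingHom BL : GL (Fin 3) ↥D.E) : Matrix (Fin 3) (Fin 3) ↥D.E) i (Fin.last 2))) :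
    ∃ (Z : SchemeOver ℂ) (κ : Z ⟶ X) (_ : IsClosedImmersion κ.left) (_ : IsReduced Z.left)
      (B₁ : UnitaryBallUniformisationDatum 1 Z),
      B₁.Hℂ = ((τ a)⁻¹ : ℂ) • Jstar.map τ ∧
      B₁.Γ.map (Matrix.GeneralLinearGroup.map (B₁.τ₁ : ↥B₁.E →+* ℂ)) = Γ₁.map (Matrix.GeneralLinearGroup.map τ) ∧
      (∀ v ∈ negCone (Jstar.map τ),
        AlgPoints.map κ (B₁.unif v) = D.unif (((BL : Matrix (Fin 3) (Fin 3) L).map τ) *ᵥ Fin.append v (0 : Fin 1 → ℂ))) ∧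
      ∀ P : ComplexPoints X, P.pt ∈ Set.range ⇑κ.left ↔
        P ∈ D.unif '' subCone D.Hℂ ((fun w ↦ D.τ₁ ∘ w) ''
          ((D.E ∙ fun i => ((Matrix.GeneralLinearGroup.map e.toRingHom BL : GL (Fin 3) ↥D.E) :
            Matrix (Fin 3) (Fin 3) ↥D.E) i (Fin.last 2) : Submodule ↥D.E (Fin 3 → ↥D.E)) : Set (Fin 3 → ↥D.E))) := by
  -- notation
  set B' : GL (Fin 3) ↥D.E := Matrix.GeneralLinearGroup.map e.toRingHom BL with hB'def
  set Jstar' : Matrix (Fin 2) (Fin 2) ↥D.E := (a⁻¹ • Jstar).map e with hJstar'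
  set Jperp' : Matrix (Fin 1) (Fin 1) ↥D.E := (a⁻¹ • Jperp).map e with hJperp'
  have hB' : formCongr (conjRingHom D.E) B' D.H = finSum 2 1 Jstar' Jperp' :=
    D.formCongr_glMap_code_eq_finSum τ e he hH BL ha Jstar Jperp hBL
  have hpos₁ : 0 < (D.E.subtype (Jperp' 0 0)).re := D.re_pos_code_subformRight τ e he Jperp hτa hτa' hpos
  have hposall : ∀ τ' : ↥D.E →+* ℂ, 0 < (τ' (Jperp' 0 0)).re := D.forall_re_pos_subformRight B' Jstar' Jperp' hB' hpos₁
  -- extend to a quotient datum and run the F-series head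
  obtain ⟨D', rfl⟩ := D.exists_quotientDatum_eq
  have hΓ₁Γ' : ∀ γ₁ ∈ Γ₁.map (Matrix.GeneralLinearGroup.map e.toRingHom),
      B' * reindexGL finSumFinEquiv (blockDiagGL (γ₁, (1 : GL (Fin 1) ↥D'.E))) * B'⁻¹ ∈ D'.Γ := by
    rintro _ ⟨γ₁, hγ₁, rfl⟩
    exact hΓ₁Γ γ₁ hγ₁
  have hΓΓ₁' : ∀ γ : D'.Γ, γ ∈ D'.lineStab (D'.E ∙ fun i => (B' : Matrix (Fin 3) (Fin 3) ↥D'.E) i (Fin.last 2)) →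
      ∃ γ₁ ∈ Γ₁.map (Matrix.GeneralLinearGroup.map e.toRingHom),
        (γ : GL (Fin 3) ↥D'.E) = B' * reindexGL finSumFinEquiv (blockDiagGL (γ₁, (1 : GL (Fin 1) ↥D'.E))) * B'⁻¹ := by
    intro γ hγ
    obtain ⟨γ₁, hγ₁, h⟩ := hΓΓ₁ γ hγ
    exact ⟨_, ⟨γ₁, hγ₁, rfl⟩, h⟩
  obtain ⟨Z, κ, hκ, hred, B₁, hH₁, hΓ₁', hcomp, hrange⟩ :=
    D'.exists_specialCurveDatum 𝔣 B' Jstar' Jperp' hB' hposall (Γ₁.map (Matrix.GeneralLinearGroup.map e.toRingHom))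
      hΓ₁ hΓ₁Γ' hΓΓ₁' hinj
  refine ⟨Z, κ, hκ, hred, B₁, ?_, ?_, ?_, ?_⟩
  · -- `B₁.Hℂ = (a⁻¹J⋆)^τ`
    rw [hH₁]
    exact D'.map_code_smul_map_subtype τ e he Jstar
  · -- `τ₁(B₁.Γ) = τ(Γ₁)`
    rw [hΓ₁']
    have h := CodeField.subgroup_map_glMap_ringEquiv_map_subtype τ e he Γ₁
    simpa only [RingEquiv.toRingHom_eq_coe] using h
  · -- `κ(ℂ)(B₁.unif v) = D.unif (B^τ(v ⊕ 0))`
    intro v hv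
    have hv' : v ∈ negCone (B₁.H.map B₁.E.subtype) := by
      have hreal : ((τ a)⁻¹ : ℂ) = (((τ a).re⁻¹ : ℝ) : ℂ) := by
        rw [Complex.ofReal_inv]
        congr 1
        exact Complex.ext rfl (by rw [Complex.ofReal_im]; exact hτa')
      rw [show B₁.H.map B₁.E.subtype = B₁.Hℂ from rfl, hH₁, D'.map_code_smul_map_subtype τ e he Jstar, hreal,
        negCone_real_smul (inv_pos.2 hτa)]
      exact hv
    rw [hcomp.unif_comp v hv', D'.embMatrix_mulVec_eq_map_mulVec_append B' v, hB'def, CodeField.coe_glMap_ringEquiv,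
      CodeField.map_ringEquiv_map_subtype τ e he]
  · -- the image is the special cycle of the line
    intro P
    have hW := D'.isTotallyPositive_span_lastCol B' Jstar' Jperp' hB' hposall
    rw [hrange]
    exact D'.pt_mem_specialSubvariety_iff _ hW P

end UnitaryBallUniformisationDatum

end Literature.AlgebraicGeometry.ShimuraVarieties

end
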